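/-
Copyright (c) 2026. All rights reserved.
Released under Apache 2.0 license as described in the file LICENSE.
Authors: abc-iut cell, statement-typer seat abc-iut-L4-t3 (wave 1).
-/
import Literature.AnabelianGeometry.AbsoluteAnabelian.LogShellsOfUnitLog
import Literature.IUT.LogVolume.LogRadius
import HarnessLib

/-!
# [AbsTopIII] Remark 5.4.2 at the standard model: the gap between `𝒪_k` and the log-shell `ℐ_k` is
bounded in terms of the ramification index

S. Mochizuki, *Topics in absolute anabelian geometry III: global reconstruction algorithms*,
J. Math. Sci. Univ. Tokyo 22 (2015) 939–1156 [MochizukiAbsTopIII2015]; locators `p.N` = pages of the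
author's manuscript (`paper:url-5493eb38cbb7`), read on the page: Rmk 5.4.2 p. 129 ("Note that in the
context of Definition 5.4, (iii), when `k` is not absolutely unramified, the “gap” between `𝒪^{Π_k}_{k∼}`
and `ℐ` may be bounded in terms of the ramification index of `k` over `ℚ_{p_k}`. We leave the routine
details to the interested reader."), Def 5.4 (iii) p. 126 (`ℐ := (p*_k)⁻¹ · ℐ* ⊆ k∼`, `𝒪 ⊆ ℐ`).

PROOF-ONLY companion (0 definitions) of `LogShells.lean` / `LogShellsOfUnitLog.lean` (abc-iut-L4-t3 /
abc-iut-L3-t11) at the STANDARD MODEL `L = PadicLogOnUnits.ofUnitLog p K` (`log = log_p`, `p* = p` or `4`), for a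
field `K` complete w.r.t. a nontrivial ultrametric norm extending `‖·‖_p` with `ProperSpace K` (an MLF): the
"routine details" are abc-iut-S1's [IUTchIV] Prop 1.2 (i) upper inclusion `log_p(𝒪_K^×) ⊆ p^{−b}·𝒪_K`
(`LogRadius.logUnits_subset_pBall_neg_logRadiusB`, `b = logRadiusB p e = ⌊log(p·e/(p−1))/log p⌋ − 1/e`), whence

  `𝒪_K ⊆ ℐ_K ⊆ p^{−(b + c)} · 𝒪_K`,  `c := ord_p(p*) ∈ {1, 2}`  (`logShell_ofUnitLog_gap`),

an enclosure whose exponent `b + c` depends only on `(p, e)` — the printed "bounded in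
terms of the ramification index". Classical and undisputed `p`-adic analysis; the node `AbsTopIII:Rmk5.4.2` of the
cell's DAG is thereby witnessed at the model (the abstract `PadicLogOnUnits` interface carries no ramification
datum, so no interface-level form is stated). Nothing here bears on [IUTchIII] Cor. 3.12.
-/

noncomputable section

open Set Metric
open scoped Pointwise

namespace Literature.AnabelianGeometry.AbsoluteAnabelian

open Literature.IUT.LogVolume Literature.NumberTheory.Transcendental

variable (p : ℕ) [hp : Fact p.Prime]
variable (K : Type*) [NontriviallyNormedField K] [instK : NormedAlgebra ℚ_[p] K]
/-- `‖(p*)⁻¹‖ = p^{c}` with `c = 2` for `p = 2` and `c = 1` otherwise, as a real power of `p`.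
[cite: MochizukiAbsTopIII2015, Def 5.4 (iii) p. 126] -/
theorem norm_pstarNat_cast_inv :
    ‖(((p ^ (if p = 2 then 2 else 1) : ℕ) : K)⁻¹)‖ = (p : ℝ) ^ ((if p = 2 then 2 else 1 : ℕ) : ℝ) := by
  rw [norm_inv, norm_pstarNat_cast p K, inv_pow, inv_inv, Real.rpow_natCast]

variable [IsUltrametricDist K] [ProperSpace K]

/-- **Rmk 5.4.2 at the standard model, upper half**: `ℐ_K ⊆ p^{−(b+c)} · 𝒪_K` with `b = logRadiusB p e`
(`e` the absolute ramification index of `K`) and `c = ord_p(p*) ∈ {1, 2}` — i.e. every element of the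
log-shell has norm `≤ p^{b + c}`. [cite: MochizukiAbsTopIII2015, Rmk 5.4.2 p. 129] -/
theorem logShell_ofUnitLog_subset_pBall :
    logShell (PadicLogOnUnits.ofUnitLog p K) ⊆
      pBall p K (-(logRadiusB p (absRamificationIdx p K) + ((if p = 2 then 2 else 1 : ℕ) : ℝ))) := by
  have hp0 : (0 : ℝ) < p := by exact_mod_cast (Fact.out : p.Prime).pos
  rw [logShell_ofUnitLog]
  rintro _ ⟨z, hz, rfl⟩
  have hz' := logUnits_subset_pBall_neg_logRadiusB p K hz
  rw [mem_pBall_iff, neg_neg] at hz' ⊢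
  show ‖(((p ^ (if p = 2 then 2 else 1) : ℕ) : K)⁻¹) • z‖ ≤ _
  rw [smul_eq_mul, norm_mul, norm_pstarNat_cast_inv p K, Real.rpow_add hp0, mul_comm]
  gcongr

/-- **Rmk 5.4.2 at the standard model** ("the “gap” between `𝒪^{Π_k}_{k∼}` and `ℐ` may be bounded in terms of
the ramification index of `k` over `ℚ_{p_k}`"): `𝒪_K ⊆ ℐ_K ⊆ p^{−(b+c)} · 𝒪_K`, where the exponent
`b + c = logRadiusB p e + ord_p(p*)` depends only on `p` and the absolute ramification index `e` of `K`.
[cite: MochizukiAbsTopIII2015, Rmk 5.4.2 p. 129] -/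
theorem logShell_ofUnitLog_gap :
    pBall p K 0 ⊆ logShell (PadicLogOnUnits.ofUnitLog p K) ∧
      logShell (PadicLogOnUnits.ofUnitLog p K) ⊆
        pBall p K (-(logRadiusB p (absRamificationIdx p K) + ((if p = 2 then 2 else 1 : ℕ) : ℝ))) := by
  refine ⟨?_, logShell_ofUnitLog_subset_pBall p K⟩
  rw [pBall_zero]
  exact closedBall_subset_logShell_ofUnitLog p K

/-- The same enclosure in closed-ball form: `closedBall 0 1 ⊆ ℐ_K ⊆ closedBall 0 (p^{b+c})`.
[cite: MochizukiAbsTopIII2015, Rmk 5.4.2 p. 129] -/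
theorem logShell_ofUnitLog_gap_closedBall :
    closedBall (0 : K) 1 ⊆ logShell (PadicLogOnUnits.ofUnitLog p K) ∧
      logShell (PadicLogOnUnits.ofUnitLog p K) ⊆
        closedBall (0 : K) ((p : ℝ) ^ (logRadiusB p (absRamificationIdx p K) + ((if p = 2 then 2 else 1 : ℕ) : ℝ))) := by
  obtain ⟨h₁, h₂⟩ := logShell_ofUnitLog_gap p K
  rw [pBall_zero] at h₁
  rw [pBall_eq_closedBall, neg_neg] at h₂
  exact ⟨h₁, h₂⟩

end Literature.AnabelianGeometry.AbsoluteAnabelian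

end
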